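import Summits.ResolutionOfSingularities.ResolutionOfSingularities.Theorems.WildConesConeExitChern
import HarnessLib

/-!
# `WildCones.ChernCriticalDirection` (stmt-ResolutionOfSingularities-16885): the Chern / Euler–Koszul
# critical-direction lemma, by name

Route `ResolutionOfSingularities/WildCones`, support item #9 (`provable-now`): for `p` an odd prime,
`s ≥ 2` and `k` algebraically closed of characteristic `p`, every non-zero form `H` of degree `p` in
`k[y₁ … y_s]` has a point `v ≠ 0` at which all partial derivatives `∂ⱼ H` vanish. Its body was landed
verbatim as `stub_chern` of line `critical-plane` of the crux `ConeExit`
(`Theorems/WildConesConeExitChern.lean`: Nullstellensatz + "in the regular local ring `k⟦y⟧` every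
system of parameters is weakly regular" (`Literature…cmClause_of_isRegularLocalRing`) + Euler's identity
`Σ yⱼ ∂ⱼH = p·H = 0` + an order comparison); this file only restates it under the route decl's name so
the support item can be closed.
-/

-- single-problem summit: the doubled namespace component `ResolutionOfSingularities` is forced
set_option linter.dupNamespace false

namespace Summit.ResolutionOfSingularities.ResolutionOfSingularities.Theorems.WildConesConeExit

open Summit.ResolutionOfSingularities.ResolutionOfSingularities.Theses.WildCones (ChernCriticalDirection)

/-- **The Chern / Euler–Koszul critical-direction lemma**, as the route decl
`WildCones.ChernCriticalDirection` (stmt-ResolutionOfSingularities-16885): for `p` an odd prime, `s ≥ 2`,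
`k` algebraically closed of characteristic `p`, every non-zero homogeneous `H` of degree `p` in `s`
variables has a non-zero common zero of its partial derivatives. Proof: `stub_chern` (verbatim body).
[cite: Jouanolou1979, Ch. 1] -/
theorem chernCriticalDirection_proof : ChernCriticalDirection := stub_chern

end Summit.ResolutionOfSingularities.ResolutionOfSingularities.Theorems.WildConesConeExit
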